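import Summits.BirchSwinnertonDyer.BirchSwinnertonDyer.Theorems.SignedLowerHalvesKobayashiLowerHalfLargeImageCommonZeroSqueezeSignBlindDefect
import Literature.NumberTheory.EllipticCurves.Kobayashi2003.SignedColemanKatoZetaJoint
import HarnessLib

/-!
# Line `commonzero_squeeze` of crux `KobayashiLowerHalfLargeImage` (item stmt-BirchSwinnertonDyer-19001): stub S1
# «the sign-blind Kato defect» FROM NAMED FACTS BY NAME — the joint `±` package fact
# `Kobayashi2003.thm62_63_73_signedColemanKato_zetaJoint` replaces the displayed hypothesis `hJ` of the sibling
# `…CommonZeroSqueezeSignBlindDefect` (cell `bsd-ssimc`, seat `bsd-line-slh-p1-w2` g3; `--supports … --as helper`)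

The sibling (p618204) proves S1's conclusion from {Kobayashi Thm. 1.2, Thm. 4.1, the two period facts} and a DISPLAYED
joint-package hypothesis (the body of the crux-line Prop `CommonZeroSqueeze.JointSignedColemanKatoZeta`). That body has
since been typed as the Literature fact `Kobayashi2003.thm62_63_73_signedColemanKato_zetaJoint` (Kobayashi 2003 Thm. 5.2 iv)
p. 9, Thm. 6.2/6.3 p. 11, Thm. 7.3 i) and proof of Thm. 7.4 p. 13, with Kato Thm. 12.5/12.6); this file restates S1 with
the fact BY NAME (definitional unfolding only), so that the line's S0 conjunct and S1 read on five NAMED published facts: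
{`thm12_signedSelmerDual_finite_torsion`, `thm41_signedCharIdeal_divisibility`, `realPeriodRat_eq_unit_mul_plusPeriod`,
`realPeriodRat_eq_unit_mul_plusPeriod_three`, `thm62_63_73_signedColemanKato_zetaJoint`}.

HONEST FRAMING (cell `bsd-ssimc`, D-0036/D-0074): TOOL THEOREM ONLY — no definition, no named fact minted, no `sorry`,
axioms standard; CONDITIONAL on the five named facts; S2/S4 of that line, the crux, every line of it and the route are NOT
closed; nothing is booked; BSD is not proved by any of this. `--supports stmt-BirchSwinnertonDyer-19001 --as helper`.

References: [Kobayashi2003] Thm. 1.2, Thm. 4.1, Thm. 5.2 iv), Thm. 6.2–6.3, Thm. 7.3 i) (7.21), proof of Thm. 7.4;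
[Kato2004Asterisque] Thm. 12.5–12.6; [GreenbergVatsal2000] §3 Rem. 3.4; [Mazur1978] Cor. 4.1.
-/

set_option autoImplicit false
-- single-problem summit (D-0017): the doubled namespace component is by design
set_option linter.dupNamespace false

noncomputable section

open scoped Classical MatrixGroups ModularForm

open CongruenceSubgroup Field WeierstrassCurve Literature.NumberTheory.EllipticCurves
  Literature.NumberTheory.EllipticCurves.ModularForms Literature.NumberTheory.GaloisRepresentations
  Literature.NumberTheory.EllipticCurves.Rank1Residual Summit.BirchSwinnertonDyer.Rank1Residual.Supersingular

namespace Summit.BirchSwinnertonDyer.BirchSwinnertonDyer.Theorems.CommonZeroSqueeze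

/-- **S1 of line `commonzero_squeeze` (the sign-blind Kato defect) from five NAMED facts**: Kobayashi Thm. 1.2 (`h12`),
Thm. 4.1 (`h41`), the period facts (`h5`, `h3`) and the joint `±` package `Kobayashi2003.thm62_63_73_signedColemanKato_zetaJoint`
(`hJ`) [all PUBLISHED; the last a construction fact, weaker than print] — for `W/ℚ` globally minimal, `p` odd good,
`a_p = 0`, `ρ̄_{E,p}` onto, every cyclotomic frame, the newform at `N_E`, every Pollack pair: ONE `δ ∈ Λ` with
`char X^ε = (ξ)`, `(ξ·δ) = (L_p^ε)` for both signs and every dual datum. Proof: the sibling's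
`signBlindDefect_of_jointPackages` applied to the unfolded fact. CONDITIONAL; closes nothing.
[cite: Kobayashi2003, Thm. 5.2 iv) (p. 9), Thm. 6.2–6.3 (p. 11), Thm. 7.3 i) (7.21) and proof of Thm. 7.4 (p. 13), Thm. 4.1 (p. 8), Thm. 1.2 (p. 2)]
[cite: Kato2004Asterisque, Thm. 12.6 (p. 222)] [cite: GreenbergVatsal2000, §3, Remark 3.4] [cite: Mazur1978, Cor. 4.1] -/
theorem signBlindDefect_of_facts
    (h12 : Kobayashi2003.thm12_signedSelmerDual_finite_torsion)
    (h41 : Kobayashi2003.thm41_signedCharIdeal_divisibility)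
    (h5 : realPeriodRat_eq_unit_mul_plusPeriod) (h3 : realPeriodRat_eq_unit_mul_plusPeriod_three)
    (hJ : Kobayashi2003.thm62_63_73_signedColemanKato_zetaJoint) :
    ∀ (W : WeierstrassCurve ℚ) [W.IsElliptic] [W.IsGloballyMinimal] (p : ℕ) [Fact p.Prime],
      p ≠ 2 → W.HasGoodReductionAtPrime p → W.frobeniusTrace p = 0 → Surj W p →
    ∀ (κ : ZpExtension ℚ p) (γ : Field.absoluteGaloisGroup ℚ),
      κ.IsCyclotomic → κ.IsTopGenerator γ → IsCyclotomicVariable p γ →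
    ∀ [NeZero (W.conductorNorm ℤ)] (f : CuspForm (Gamma0 (W.conductorNorm ℤ)) 2), IsNewformOf W f →
    ∀ (Lplus Lminus : IwasawaAlgebra p), IsPollackPair f p Lplus Lminus →
      ∃ δ : IwasawaAlgebra p, ∀ (ε : ℤˣ) (D : Kobayashi2003.SignedSelmerDualData W κ γ ε),
        ∃ ξ : IwasawaAlgebra p, D.charIdeal = Ideal.span {ξ} ∧
          Ideal.span {ξ * δ} = Ideal.span {kobayashiL ε Lplus Lminus} :=
  signBlindDefect_of_jointPackages h12 h41 h5 h3 hJ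

end Summit.BirchSwinnertonDyer.BirchSwinnertonDyer.Theorems.CommonZeroSqueeze

end
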